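import Summits.Ventures.HodgeRepro2.T5BergmanParseval
import Summits.Ventures.HodgeRepro2.T5BergmanLowestWeight

/-!
# The `K`-types of the weighted Bergman model: each weight `k, k+2, k+4, …` occurs exactly once

For the weight-`k` model of `T5BergmanCoefficient` the rotation subgroup `K = {rot u}` acts on `zⁿ` by
`u ↦ u^{-(k+2n)}` (`T5BergmanCoefficientL2.act_rot_monomial`).  This file proves the converse:

* **uniqueness of power-series coefficients on `𝔻`** (`coeff_unique`) — from Parseval in `[0,∞]`
  (`T5BergmanParseval.lintegral_sq_weight_eq_tsum`): a series with sum `0` on `𝔻` has all coefficients `0`;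
* **each `K`-type occurs at most once** (`eq_mul_monomial_of_weight`): a holomorphic `f` on `𝔻` with
  `π_k(rot u) f = u^{-(k+2n)} f` on `𝔻` for every `u` is `a_n zⁿ`;
* **no other weights occur** (`eq_zero_of_weight_of_forall_ne`): a weight vector whose weight is not of the
  form `k + 2n` is `0`.

Together with `T5BergmanCoefficientL2.act_rot_monomial` and the density of the polynomials
(`T5BergmanParseval.tendsto_pairing_sub_partialSum`) this is the `K`-type decomposition of the model:
`A_k = ⨁̂_{n ≥ 0} ℂ · zⁿ`, weights `k, k+2, k+4, …`, each with multiplicity one — the lowest weight `k` on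
the constants (`T5BergmanLowestWeight.weight_iff_const`).

Blind lane: Mathlib + the HodgeRepro2 prefix only; no sorry; axioms ⊆ {propext, Classical.choice,
Quot.sound}.
-/

namespace Summit.Ventures.HodgeRepro2.T5BergmanKTypes

open MeasureTheory Metric Filter Topology T5BergmanCoefficient T5BergmanParseval T5BergmanLowestWeight
  T5SU11Fibration
open scoped Real ENNReal

/-! ### Uniqueness of the coefficients -/

/-- A power series with sum `0` on `𝔻` has all coefficients `0` (Parseval in `[0, ∞]` at weight `2`). -/
theorem coeff_eq_zero_of_hasSum_zero (a : ℕ → ℂ)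
    (h : ∀ z ∈ ball (0 : ℂ) 1, HasSum (fun n => a n * z ^ n) 0) (n : ℕ) : a n = 0 := by
  have key := lintegral_sq_weight_eq_tsum 2 le_rfl a (fun _ => 0) (fun z hz => h z hz)
  simp only [norm_zero, ne_eq, OfNat.ofNat_ne_zero, not_false_eq_true, zero_pow, zero_mul,
    ENNReal.ofReal_zero, lintegral_const] at key
  have h2 : ENNReal.ofReal (‖a n‖ ^ 2 * monomialNormSq 2 n) = 0 :=
    (ENNReal.tsum_eq_zero.mp key.symm) n
  rw [ENNReal.ofReal_eq_zero] at h2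
  have hc := monomialNormSq_pos 2 n
  have h3 : ‖a n‖ ^ 2 ≤ 0 := by
    by_contra h4
    have : 0 < ‖a n‖ ^ 2 * monomialNormSq 2 n := mul_pos (lt_of_not_ge h4) hc
    linarith
  have h5 : ‖a n‖ = 0 := by nlinarith [norm_nonneg (a n)]
  exact norm_eq_zero.mp h5

/-- **Uniqueness of the coefficients** of a power series on `𝔻`. -/
theorem coeff_unique (a b : ℕ → ℂ) (f : ℂ → ℂ)
    (ha : ∀ z ∈ ball (0 : ℂ) 1, HasSum (fun n => a n * z ^ n) (f z))
    (hb : ∀ z ∈ ball (0 : ℂ) 1, HasSum (fun n => b n * z ^ n) (f z)) : a = b := by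
  funext n
  have := coeff_eq_zero_of_hasSum_zero (fun n => a n - b n) (fun z hz => by
    have := (ha z hz).sub (hb z hz)
    rw [sub_self] at this
    refine this.congr_fun fun m => ?_
    ring) n
  exact sub_eq_zero.mp this

/-! ### The rotation action on the coefficients -/

/-- `π_k(rot u) f` has coefficients `u^{-(k+2m)} a_m`. -/
theorem hasSum_act_rot (k : ℕ) (u : Circle) (a : ℕ → ℂ) (f : ℂ → ℂ)
    (hf : ∀ z ∈ ball (0 : ℂ) 1, HasSum (fun n => a n * z ^ n) (f z)) {z : ℂ}
    (hz : z ∈ ball (0 : ℂ) 1) :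
    HasSum (fun m => (((u : ℂ)⁻¹) ^ (k + 2 * m) * a m) * z ^ m) (act k (rot u) f z) := by
  rw [act_rot]
  have hz' : ((u : ℂ)⁻¹) ^ 2 * z ∈ ball (0 : ℂ) 1 := by
    rw [mem_ball_zero_iff, norm_mul, norm_pow, norm_inv, Circle.norm_coe, inv_one, one_pow, one_mul]
    exact mem_ball_zero_iff.mp hz
  refine ((hf _ hz').mul_left (((u : ℂ)⁻¹) ^ k)).congr_fun fun m => ?_
  rw [mul_pow, ← pow_mul, pow_add]
  ring

/-- A `u ∈ U(1)` with `u^d = -1` for `d ≠ 0`: `u = e^{iπ/d}`. -/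
lemma exists_pow_eq_neg_one {d : ℕ} (hd : d ≠ 0) : ∃ u : Circle, (u : ℂ) ^ d = -1 := by
  refine ⟨Circle.exp (π / d), ?_⟩
  have hd0 : (d : ℂ) ≠ 0 := by exact_mod_cast hd
  rw [Circle.coe_exp, ← Complex.exp_nat_mul]
  push_cast
  rw [show (d : ℂ) * ((π : ℂ) / d * Complex.I) = π * Complex.I by field_simp, Complex.exp_pi_mul_I]

/-- A coefficient carrying two different characters of `U(1)` vanishes:
`u^{-p} a = u^{-q} a` for all `u ∈ U(1)` with `p ≠ q` forces `a = 0`. -/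
lemma eq_zero_of_forall_inv_pow_mul_eq {a : ℂ} {p q : ℕ} (hpq : p ≠ q)
    (h : ∀ u : Circle, ((u : ℂ)⁻¹) ^ p * a = ((u : ℂ)⁻¹) ^ q * a) : a = 0 := by
  -- reduce to `p < q`
  suffices key : ∀ {p q : ℕ}, p < q →
      (∀ u : Circle, ((u : ℂ)⁻¹) ^ p * a = ((u : ℂ)⁻¹) ^ q * a) → a = 0 by
    rcases lt_or_gt_of_ne hpq with hlt | hgt
    · exact key hlt h
    · exact key hgt fun u => (h u).symm
  intro p q hlt h
  obtain ⟨d, rfl⟩ := Nat.exists_eq_add_of_lt hlt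
  obtain ⟨u, hu⟩ := exists_pow_eq_neg_one (d := d + 1) (by omega)
  have hk := h u
  have hinv : ((u : ℂ)⁻¹) ^ (d + 1) = -1 := by rw [inv_pow, hu, inv_neg_one]
  rw [show ((u : ℂ)⁻¹) ^ (p + d + 1) = ((u : ℂ)⁻¹) ^ p * ((u : ℂ)⁻¹) ^ (d + 1) by
      rw [← pow_add]; ring_nf,
    hinv] at hk
  have hne : ((u : ℂ)⁻¹) ^ p ≠ 0 := pow_ne_zero _ (inv_ne_zero (Circle.coe_ne_zero u))
  have h2 : ((u : ℂ)⁻¹) ^ p * (2 * a) = 0 := by linear_combination hk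
  rcases mul_eq_zero.mp h2 with h' | h'
  · exact absurd h' hne
  · exact (mul_eq_zero.mp h').resolve_left two_ne_zero

/-! ### Each `K`-type occurs at most once -/

/-- The coefficient identity forced by a weight condition: if `π_k(rot u) f = u^{-j} f` on `𝔻` for every
`u`, then `u^{-(k+2m)} a_m = u^{-j} a_m` for every `u` and `m`. -/
theorem coeff_identity_of_weight (k j : ℕ) (a : ℕ → ℂ) (f : ℂ → ℂ)
    (hf : ∀ z ∈ ball (0 : ℂ) 1, HasSum (fun m => a m * z ^ m) (f z))
    (hw : ∀ (u : Circle), ∀ z ∈ ball (0 : ℂ) 1, act k (rot u) f z = ((u : ℂ)⁻¹) ^ j * f z)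
    (u : Circle) (m : ℕ) :
    ((u : ℂ)⁻¹) ^ (k + 2 * m) * a m = ((u : ℂ)⁻¹) ^ j * a m := by
  have h1 : ∀ z ∈ ball (0 : ℂ) 1,
      HasSum (fun m => (((u : ℂ)⁻¹) ^ (k + 2 * m) * a m) * z ^ m) (act k (rot u) f z) :=
    fun z hz => hasSum_act_rot k u a f hf hz
  have h2 : ∀ z ∈ ball (0 : ℂ) 1,
      HasSum (fun m => (((u : ℂ)⁻¹) ^ j * a m) * z ^ m) (act k (rot u) f z) := by
    intro z hz
    rw [hw u z hz]
    refine ((hf z hz).mul_left (((u : ℂ)⁻¹) ^ j)).congr_fun fun m => ?_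
    ring
  exact congrFun (coeff_unique _ _ _ h1 h2) m

/-- **Each `K`-type occurs at most once**: if `π_k(rot u) f = u^{-(k+2n)} f` on `𝔻` for every `u`, then
`f = a_n zⁿ` on `𝔻`. -/
theorem eq_mul_monomial_of_weight (k n : ℕ) (a : ℕ → ℂ) (f : ℂ → ℂ)
    (hf : ∀ z ∈ ball (0 : ℂ) 1, HasSum (fun m => a m * z ^ m) (f z))
    (hw : ∀ (u : Circle), ∀ z ∈ ball (0 : ℂ) 1,
      act k (rot u) f z = ((u : ℂ)⁻¹) ^ (k + 2 * n) * f z) :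
    ∀ z ∈ ball (0 : ℂ) 1, f z = a n * z ^ n := by
  have hzero : ∀ m, m ≠ n → a m = 0 := fun m hmn =>
    eq_zero_of_forall_inv_pow_mul_eq (p := k + 2 * m) (q := k + 2 * n) (by omega)
      fun u => coeff_identity_of_weight k (k + 2 * n) a f hf hw u m
  intro z hz
  have h3 : HasSum (fun m => a m * z ^ m) (a n * z ^ n) :=
    hasSum_single n fun m hm => by rw [hzero m hm, zero_mul]
  exact (hf z hz).unique h3

/-- **No weight outside `{k, k+2, k+4, …}` occurs**: if `π_k(rot u) f = u^{-j} f` on `𝔻` for every `u` and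
`j ≠ k + 2n` for all `n`, then `f = 0` on `𝔻`. -/
theorem eq_zero_of_weight_of_forall_ne (k j : ℕ) (a : ℕ → ℂ) (f : ℂ → ℂ)
    (hf : ∀ z ∈ ball (0 : ℂ) 1, HasSum (fun m => a m * z ^ m) (f z))
    (hw : ∀ (u : Circle), ∀ z ∈ ball (0 : ℂ) 1, act k (rot u) f z = ((u : ℂ)⁻¹) ^ j * f z)
    (hj : ∀ n, j ≠ k + 2 * n) :
    ∀ z ∈ ball (0 : ℂ) 1, f z = 0 := by
  have hzero : ∀ m, a m = 0 := fun m =>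
    eq_zero_of_forall_inv_pow_mul_eq (p := k + 2 * m) (q := j) (hj m).symm
      fun u => coeff_identity_of_weight k j a f hf hw u m
  intro z hz
  have h3 : HasSum (fun m => a m * z ^ m) 0 :=
    hasSum_zero.congr_fun fun m => by rw [hzero m, zero_mul]
  exact (hf z hz).unique h3

/-- The `K`-type decomposition for holomorphic `f`: a holomorphic weight vector of weight `k + 2n` on `𝔻`
is `f^{(n)}(0)/n! · zⁿ`. -/
theorem eq_mul_monomial_of_weight_of_differentiableOn (k n : ℕ) (f : ℂ → ℂ)
    (hf : DifferentiableOn ℂ f (ball 0 1))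
    (hw : ∀ (u : Circle), ∀ z ∈ ball (0 : ℂ) 1,
      act k (rot u) f z = ((u : ℂ)⁻¹) ^ (k + 2 * n) * f z) :
    ∀ z ∈ ball (0 : ℂ) 1, f z = taylorCoeff f n * z ^ n :=
  eq_mul_monomial_of_weight k n _ f (hasSum_taylor f hf) hw

end Summit.Ventures.HodgeRepro2.T5BergmanKTypes
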